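import Mathlib.LinearAlgebra.FiniteDimensional.Lemmas
import HarnessLib

/-!
# Landsberg–Ressayre, Thm. 2.8 — canonical subspaces of an equivariant pencil (LR17 §3.6, §6)

Topic `Literature/Computability/AlgebraicComplexity`.  Part of the bottom-up proof of the named
fact `lr_left_equivariant_lower` (`LandsbergRessayre.lean`, LR17 Thm. 2.8), in an elementary
reformulation of LR17 §6 that avoids algebraic groups (Levi–Malcev, central tori): the chain of
`L'`-submodules `ℍ_1, ℍ_2, …` of LR17 §3.6/§6 ("the projection of `A(V)` on `ℓ_1^* ⊗ ℍ` is
non-zero … continuing, one gets a sequence `ℍ_1, …, ℍ_k`") is replaced by CANONICAL subspaces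
attached to the linear-algebra datum of a determinantal representation `Ã = Λ + Σ x_{kj} A_{kj}`:

* `IsClosedUnder Λ A S P`: `A_{kj} (Λ⁻¹ P) ⊆ P` for all rows `k ∈ S` and all columns `j`;
* `canon Λ A S = 𝒫_S`: the smallest such subspace (it contains `A_{kj} (ker Λ)`, `k ∈ S`, and is
  obtained from `ker Λ` by iterating `P ↦ P + Σ_{k ∈ S, j} A_{kj} Λ⁻¹ P` — LR's chain);
* `PermLift`: an exact lift `(B, C)` of a row permutation `σ` (`B Λ = Λ C`,
  `B A_{kj} = A_{σ k, j} C`), and the COVARIANCE `B 𝒫_S = 𝒫_{σ S}` (`map_canon_eq`), which is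
  what makes `𝒫_S` a substitute for LR's irreducible `L'`-modules: the statements
  "`𝒫_S ⊄ range Λ`" and "`𝒫_S ⊄ Σ_{S' ⊊ S} 𝒫_{S'}`" are transported along `σ`
  (`not_canon_le_range_iff`, `canon_le_iSup_ssubsets_transfer`);
* the ESCAPE lemma `not_canon_univ_le_range` (LR17 §3.6: "for the determinant to be non-zero,
  we need the projection to `ℓ_1^* ⊗ ℍ` to be non-zero", iterated): if `ker Λ ≠ 0` and some
  member `Λ + Σ x_{kj} A_{kj}` of the pencil is injective, then `𝒫_{[m]} ⊄ range Λ`.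

Everything here is linear algebra over a field; the torus weights enter in `LRTorusWeights.lean`.

## References

* J. M. Landsberg, N. Ressayre, *Permanent v. determinant: an exponential lower bound assuming
  symmetry and a potential path towards Valiant's conjecture*, Differential Geom. Appl. 55 (2017)
  146–166, arXiv:1508.05788: §3.6 (outline), §6 (proof of Thm. 2.8).
-/

noncomputable section

namespace Literature.Computability.AlgebraicComplexity

namespace LRPencil

open Submodule

variable {K : Type*} [Field K] {V : Type*} [AddCommGroup V] [Module K V] {m : ℕ}

/-! ### Closed subspaces and the canonical subspaces `𝒫_S` -/

section Canon

variable (Λ : Module.End K V) (A : Fin m → Fin m → Module.End K V)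

/-- `P` is closed under the rows in `S`: `A_{kj} (Λ⁻¹ P) ⊆ P` for all `k ∈ S` and all `j`
(the inductive step "`ℍ_i ↦ ℍ_{i+1}`" of LR17 §3.6/§6, as a closure condition).
[cite: LandsbergRessayre2017, §3.6] -/
def IsClosedUnder (S : Finset (Fin m)) (P : Submodule K V) : Prop :=
  ∀ k ∈ S, ∀ j : Fin m, (P.comap Λ).map (A k j) ≤ P

/-- The canonical subspace `𝒫_S`: the smallest subspace closed under the rows in `S`
(LR17 §6: the span of the chain `ℍ_1, ℍ_2, …` built from `ker Λ` using only the rows in `S`).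
[cite: LandsbergRessayre2017, §6] -/
def canon (S : Finset (Fin m)) : Submodule K V :=
  sInf {P : Submodule K V | IsClosedUnder Λ A S P}

variable {Λ A}

/-- Closedness is antitone in the set of rows. [cite: LandsbergRessayre2017, §6] -/
theorem IsClosedUnder.anti {S S' : Finset (Fin m)} {P : Submodule K V}
    (h : IsClosedUnder Λ A S P) (hS : S' ⊆ S) : IsClosedUnder Λ A S' P :=
  fun k hk j => h k (hS hk) j

/-- `𝒫_S` is closed under the rows in `S`. [cite: LandsbergRessayre2017, §6] -/
theorem isClosedUnder_canon (S : Finset (Fin m)) : IsClosedUnder Λ A S (canon Λ A S) := by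
  intro k hk j
  refine le_sInf fun P hP => ?_
  have h1 : canon Λ A S ≤ P := sInf_le hP
  exact (Submodule.map_mono (Submodule.comap_mono h1)).trans (hP k hk j)

/-- `𝒫_S` is the least closed subspace. [cite: LandsbergRessayre2017, §6] -/
theorem canon_le {S : Finset (Fin m)} {P : Submodule K V} (hP : IsClosedUnder Λ A S P) :
    canon Λ A S ≤ P :=
  sInf_le hP

/-- `𝒫_S` is monotone in `S`. [cite: LandsbergRessayre2017, §6] -/
theorem canon_mono {S S' : Finset (Fin m)} (h : S' ⊆ S) : canon Λ A S' ≤ canon Λ A S :=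
  canon_le ((isClosedUnder_canon S).anti h)

/-- `ker Λ ⊆ Λ⁻¹ P` for every `P`. [folklore] -/
theorem ker_le_comap (P : Submodule K V) : LinearMap.ker Λ ≤ P.comap Λ := by
  rw [← Submodule.comap_bot]; exact Submodule.comap_mono bot_le

/-- `A_{kj} (ker Λ) ⊆ 𝒫_S` for `k ∈ S` (LR17 §3.6: `ℍ_1`, the image of the first column block).
[cite: LandsbergRessayre2017, §3.6] -/
theorem map_ker_le_canon {S : Finset (Fin m)} {k : Fin m} (hk : k ∈ S) (j : Fin m) :
    (LinearMap.ker Λ).map (A k j) ≤ canon Λ A S :=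
  (Submodule.map_mono (ker_le_comap _)).trans (isClosedUnder_canon S k hk j)

/-- `𝒫_S = Σ_{k ∈ S, j} A_{kj} Λ⁻¹ 𝒫_S` (here the inclusion `⊆`): every element of `𝒫_S` is
produced by one more step of the chain. [cite: LandsbergRessayre2017, §6] -/
theorem canon_le_step (S : Finset (Fin m)) :
    canon Λ A S ≤ ⨆ k ∈ S, ⨆ j, ((canon Λ A S).comap Λ).map (A k j) := by
  set T : Submodule K V := ⨆ k ∈ S, ⨆ j, ((canon Λ A S).comap Λ).map (A k j) with hT
  have hTle : T ≤ canon Λ A S :=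
    iSup₂_le fun k hk => iSup_le fun j => isClosedUnder_canon S k hk j
  apply canon_le
  intro k hk j
  calc ((T.comap Λ).map (A k j)) ≤ ((canon Λ A S).comap Λ).map (A k j) :=
        Submodule.map_mono (Submodule.comap_mono hTle)
    _ ≤ ⨆ j, ((canon Λ A S).comap Λ).map (A k j) :=
        le_iSup (fun j => ((canon Λ A S).comap Λ).map (A k j)) j
    _ ≤ T := by
        rw [hT]
        exact le_biSup (fun k => ⨆ j, ((canon Λ A S).comap Λ).map (A k j)) hk

end Canon

/-! ### The escape lemma -/

section Escape

variable {Λ : Module.End K V} {A : Fin m → Fin m → Module.End K V}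

/-- The member `Λ + Σ x_{kj} A_{kj}` of the pencil maps `Λ⁻¹ P` into `P` when `P` is closed
under all rows. [cite: LandsbergRessayre2017, §3.6] -/
theorem pencil_mem_of_mem_comap {P : Submodule K V} (hP : IsClosedUnder Λ A Finset.univ P)
    (x : Fin m → Fin m → K) {w : V} (hw : w ∈ P.comap Λ) :
    (Λ + ∑ k, ∑ j, x k j • A k j) w ∈ P := by
  rw [LinearMap.add_apply]
  refine P.add_mem hw ?_
  rw [LinearMap.coe_sum, Finset.sum_apply]
  refine P.sum_mem fun k _ => ?_
  rw [LinearMap.coe_sum, Finset.sum_apply]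
  refine P.sum_mem fun j _ => ?_
  rw [LinearMap.smul_apply]
  exact P.smul_mem _ (hP k (Finset.mem_univ k) j (Submodule.mem_map_of_mem hw))

/-- `dim Λ⁻¹ P = dim P + dim ker Λ` when `P ⊆ range Λ`. [folklore] -/
theorem finrank_comap_eq [FiniteDimensional K V] {P : Submodule K V} (hP : P ≤ LinearMap.range Λ) :
    Module.finrank K (P.comap Λ) = Module.finrank K P + Module.finrank K (LinearMap.ker Λ) := by
  set f : P.comap Λ →ₗ[K] V := Λ.domRestrict (P.comap Λ) with hf
  have hrange : LinearMap.range f = P := by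
    apply le_antisymm
    · rintro _ ⟨w, rfl⟩
      exact w.2
    · intro v hv
      obtain ⟨w, rfl⟩ := hP hv
      exact ⟨⟨w, hv⟩, rfl⟩
  have hker : LinearMap.ker f = (LinearMap.ker Λ).comap (P.comap Λ).subtype := by
    ext w
    simp [hf]
  have e : (LinearMap.ker Λ).comap (P.comap Λ).subtype ≃ₗ[K] LinearMap.ker Λ :=
    Submodule.comapSubtypeEquivOfLe (ker_le_comap P)
  have h := LinearMap.finrank_range_add_finrank_ker f
  rw [hrange, hker, e.finrank_eq] at h
  exact h.symm

/-- **Escape lemma** (LR17 §3.6, "for the determinant to be non-zero, we need the projection to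
`ℓ_1^* ⊗ ℍ` to be non-zero", in closed form): if `ker Λ ≠ 0` and some member of the pencil is
injective, then `𝒫_{[m]} ⊄ range Λ` — otherwise every member maps `Λ⁻¹ 𝒫_{[m]}`, of dimension
`dim 𝒫_{[m]} + dim ker Λ`, into `𝒫_{[m]}`. [cite: LandsbergRessayre2017, §3.6] -/
theorem not_canon_univ_le_range [FiniteDimensional K V] (hK : LinearMap.ker Λ ≠ ⊥)
    (hgen : ∃ x : Fin m → Fin m → K, Function.Injective (Λ + ∑ k, ∑ j, x k j • A k j)) :
    ¬ canon Λ A Finset.univ ≤ LinearMap.range Λ := by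
  intro hle
  obtain ⟨x, hx⟩ := hgen
  set P := canon Λ A (Finset.univ : Finset (Fin m)) with hPdef
  set T : Module.End K V := Λ + ∑ k, ∑ j, x k j • A k j with hTdef
  have hmaps : ∀ w ∈ P.comap Λ, T w ∈ P := fun w hw =>
    pencil_mem_of_mem_comap (isClosedUnder_canon Finset.univ) x hw
  let g : P.comap Λ →ₗ[K] P := LinearMap.codRestrict P (T.domRestrict (P.comap Λ)) fun w => hmaps w w.2
  have hg : Function.Injective g := by
    intro w w' h
    apply Subtype.ext
    apply hx
    have := congrArg Subtype.val h
    simpa [g] using this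
  have h1 := LinearMap.finrank_le_finrank_of_injective hg
  rw [finrank_comap_eq hle] at h1
  have h2 : 0 < Module.finrank K (LinearMap.ker Λ) := by
    rw [pos_iff_ne_zero, Ne, Submodule.finrank_eq_zero]
    exact hK
  omega

end Escape

/-! ### Lifts of monomial symmetries and covariance -/

section Lift

variable (Λ : Module.End K V) (A : Fin m → Fin m → Module.End K V)

/-- An EXACT LIFT of the monomial row symmetry `x ↦ P_σ · diag(c) · x` to the pencil:
automorphisms `B`, `C` of `V` with `B Λ = Λ C` and `B A_{kj} = c_k · A_{σ k, j} C` (the tree's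
`IsEquivariantDetRepr` unpacked on the constant and the linear part; LR17 Def. 1.3 together with
`𝔾_A ⊆ Stab Λ`, Def. 1.2).  `σ = 1` is a lift of the torus element `diag(c)`, `c = 1` a lift of
the permutation `σ`. [cite: LandsbergRessayre2017, Def. 1.3] -/
structure Lift (σ : Equiv.Perm (Fin m)) (c : Fin m → K) where
  /-- the automorphism on the target side -/
  B : V ≃ₗ[K] V
  /-- the automorphism on the source side -/
  C : V ≃ₗ[K] V
  /-- the scalars are invertible -/
  c_ne : ∀ k, c k ≠ 0
  /-- `B Λ = Λ C` -/
  comm_Λ : ∀ v, B (Λ v) = Λ (C v)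
  /-- `B A_{kj} = c_k · A_{σ k, j} C` -/
  comm_A : ∀ k j v, B (A k j v) = c k • A (σ k) j (C v)

variable {Λ A}

namespace Lift

variable {σ : Equiv.Perm (Fin m)} {c : Fin m → K} (L : Lift Λ A σ c)

/-- The inverse lift lifts the inverse symmetry `x ↦ diag(c)⁻¹ P_σ⁻¹ x`.
[cite: LandsbergRessayre2017, Def. 1.3] -/
def symm : Lift Λ A σ⁻¹ (fun k => (c (σ⁻¹ k))⁻¹) where
  B := L.B.symm
  C := L.C.symm
  c_ne k := inv_ne_zero (L.c_ne _)
  comm_Λ v := by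
    apply L.B.injective
    rw [LinearEquiv.apply_symm_apply, L.comm_Λ, LinearEquiv.apply_symm_apply]
  comm_A k j v := by
    apply L.B.injective
    rw [LinearEquiv.apply_symm_apply, map_smul, L.comm_A, LinearEquiv.apply_symm_apply,
      show σ (σ⁻¹ k) = k from σ.apply_symm_apply k, smul_smul, inv_mul_cancel₀ (L.c_ne _),
      one_smul]

/-- `B Λ = Λ C` as linear maps. [cite: LandsbergRessayre2017, Def. 1.3] -/
theorem comp_Λ : (L.B : V →ₗ[K] V) ∘ₗ Λ = Λ ∘ₗ (L.C : V →ₗ[K] V) :=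
  LinearMap.ext fun v => L.comm_Λ v

/-- `B A_{kj} = c_k · A_{σ k, j} C` as linear maps. [cite: LandsbergRessayre2017, Def. 1.3] -/
theorem comp_A (k j : Fin m) :
    (L.B : V →ₗ[K] V) ∘ₗ A k j = c k • (A (σ k) j ∘ₗ (L.C : V →ₗ[K] V)) :=
  LinearMap.ext fun v => L.comm_A k j v

/-- `Λ⁻¹ (B P) = C (Λ⁻¹ P)`. [folklore] -/
theorem comap_map_eq (P : Submodule K V) :
    (P.map (L.B : V →ₗ[K] V)).comap Λ = (P.comap Λ).map (L.C : V →ₗ[K] V) := by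
  ext w
  rw [Submodule.map_equiv_eq_comap_symm, Submodule.map_equiv_eq_comap_symm]
  simp only [Submodule.mem_comap, LinearEquiv.coe_coe]
  rw [show L.B.symm (Λ w) = Λ (L.C.symm w) from L.symm.comm_Λ w]

/-- `B (range Λ) = range Λ`. [folklore] -/
theorem map_range_eq : (LinearMap.range Λ).map (L.B : V →ₗ[K] V) = LinearMap.range Λ := by
  rw [← LinearMap.range_comp, L.comp_Λ, LinearMap.range_comp, LinearEquiv.range, Submodule.map_top]

/-- `B (ker Λ) = ker Λ`, i.e. `C (ker Λ) = ker Λ` on the source side. [folklore] -/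
theorem map_ker_eq : (LinearMap.ker Λ).map (L.C : V →ₗ[K] V) = LinearMap.ker Λ := by
  rw [← Submodule.comap_bot, ← L.comap_map_eq, Submodule.map_bot]

/-- Covariance, first half: `𝒫_{σ S} ⊆ B 𝒫_S`. [cite: LandsbergRessayre2017, §6] -/
theorem canon_map_le (S : Finset (Fin m)) :
    canon Λ A (S.map σ.toEmbedding) ≤ (canon Λ A S).map (L.B : V →ₗ[K] V) := by
  apply canon_le
  intro k' hk' j
  obtain ⟨k, hk, rfl⟩ := Finset.mem_map.1 hk'
  rw [L.comap_map_eq, ← Submodule.map_comp, Equiv.coe_toEmbedding,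
    ← Submodule.map_smul _ _ (c k) (L.c_ne k), ← L.comp_A, Submodule.map_comp]
  exact Submodule.map_mono (isClosedUnder_canon S k hk j)

/-- Covariance, second half: `B 𝒫_S ⊆ 𝒫_{σ S}`. [cite: LandsbergRessayre2017, §6] -/
theorem map_canon_le (S : Finset (Fin m)) :
    (canon Λ A S).map (L.B : V →ₗ[K] V) ≤ canon Λ A (S.map σ.toEmbedding) := by
  rw [Submodule.map_le_iff_le_comap]
  apply canon_le
  intro k hk j
  have hkσ : σ k ∈ S.map σ.toEmbedding := (Finset.mem_map' σ.toEmbedding).2 hk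
  rw [← Submodule.map_le_iff_le_comap, ← Submodule.map_comp, L.comp_A,
    Submodule.map_smul _ _ (c k) (L.c_ne k), Submodule.map_comp,
    ← Submodule.comap_comp, L.comp_Λ, Submodule.comap_comp,
    Submodule.map_comap_eq_of_surjective L.C.surjective]
  exact isClosedUnder_canon _ (σ k) hkσ j

/-- **Covariance**: `B 𝒫_S = 𝒫_{σ S}` — the canonical subspaces are permuted by the lifts exactly as
LR's weight spaces (LR17 §6: `Wt(T̃, W)` is an orbit); for a torus lift (`σ = 1`) this says that
`𝒫_S` is `B`-stable. [cite: LandsbergRessayre2017, §6] -/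
theorem map_canon_eq (S : Finset (Fin m)) :
    (canon Λ A S).map (L.B : V →ₗ[K] V) = canon Λ A (S.map σ.toEmbedding) :=
  le_antisymm (L.map_canon_le S) (L.canon_map_le S)

/-- Transport of the escape property: `𝒫_S ⊆ range Λ ↔ 𝒫_{σS} ⊆ range Λ`.
[cite: LandsbergRessayre2017, §6] -/
theorem canon_le_range_iff (L : Lift Λ A σ c) (S : Finset (Fin m)) :
    canon Λ A (S.map σ.toEmbedding) ≤ LinearMap.range Λ ↔ canon Λ A S ≤ LinearMap.range Λ := by
  rw [← L.map_canon_eq]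
  conv_lhs => rw [← L.map_range_eq]
  exact Submodule.map_le_map_iff_of_injective L.B.injective _ _

/-- Transport of "`𝒫_S ⊆ Σ_{S' ⊊ S} 𝒫_{S'}`" along a lift (one direction; the other is the same
statement for the inverse lift). [cite: LandsbergRessayre2017, §6] -/
theorem canon_le_iSup_ssubsets_transfer (L : Lift Λ A σ c) {S : Finset (Fin m)}
    (h : canon Λ A S ≤ ⨆ (S' : Finset (Fin m)) (_ : S' ⊂ S), canon Λ A S') :
    canon Λ A (S.map σ.toEmbedding) ≤
      ⨆ (T : Finset (Fin m)) (_ : T ⊂ S.map σ.toEmbedding), canon Λ A T := by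
  rw [← L.map_canon_eq]
  refine (Submodule.map_mono h).trans ?_
  rw [Submodule.map_iSup]
  refine iSup_le fun S' => ?_
  rw [Submodule.map_iSup]
  refine iSup_le fun hS' => ?_
  rw [L.map_canon_eq]
  have : S'.map σ.toEmbedding ⊂ S.map σ.toEmbedding := Finset.map_ssubset_map.2 hS'
  exact le_biSup (fun T => canon Λ A T) this

/-- For a torus lift (`σ = 1`): `𝒫_S` is `B`-stable. [cite: LandsbergRessayre2017, §6] -/
theorem map_canon_eq_self (L : Lift Λ A 1 c) (S : Finset (Fin m)) :
    (canon Λ A S).map (L.B : V →ₗ[K] V) = canon Λ A S := by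
  rw [L.map_canon_eq, Equiv.Perm.one_def, Equiv.refl_toEmbedding, Finset.map_refl]

end Lift

end Lift

end LRPencil

end Literature.Computability.AlgebraicComplexity
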